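import Summits.Ventures.QEC.Theses.BB108DistanceCertificate
import HarnessLib

/-!
# `[[108,8,10]]` route — the ASSEMBLY item (stmt-Ventures-19831)

`Assembly := NoZLogicalBelowTen108 → WeightTenZLogical108 → EightLogicalQubits108 → BB108_8_10_claim` is exactly the
implication the route's deciding theorem `closes` proves (lower bound + weight-10 witness ⇒
`d^Z(BB.bb108) = 10` by `CSSCode.dZ_eq_of_witness`; `n = 108` by counting; `k = 8`; then `hasParams_of_dZ`,
Bravyi et al. Lemma 1 `d = d^Z`). HONEST FRAMING: this file certifies nothing about the code by itself —
the claim `BB108_8_10_claim` becomes a theorem only when the lower-bound item lands.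
-/

namespace Summit.Ventures.QEC.Theorems

/-- **Assembly of route `BB108DistanceCertificate`**: the three items imply the `[[108,8,10]]` claim
(by the route's deciding theorem `closes`). [proved] -/
theorem bb108DistanceCertificate_assembly_proof :
    Summit.Ventures.QEC.Theses.BB108DistanceCertificate.Assembly :=
  fun hL hU hK => Summit.Ventures.QEC.Theses.BB108DistanceCertificate.closes hL hU hK

end Summit.Ventures.QEC.Theorems
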